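import Summits.HodgeConjecture.HodgeConjecture.Theorems.PadicSemiregularLiftHodgeFermatVarietiesFibreOfBoundaryPow
import Summits.HodgeConjecture.HodgeConjecture.Theorems.PadicSemiregularLiftHodgeFermatVarietiesFiveQFourierSplit
import Summits.HodgeConjecture.HodgeConjecture.Theorems.PadicSemiregularLiftHodgeFermatVarietiesFiveQStructure
import Summits.HodgeConjecture.HodgeConjecture.Theorems.PadicSemiregularLiftHodgeFermatVarietiesPQStructure
import Summits.HodgeConjecture.HodgeConjecture.Theorems.PadicSemiregularLiftHodgeFermatVarietiesGeneralPayoff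
import HarnessLib

/-!
# GP without the twin exclusion, I — the parity-free Fourier split on `(ℤ/qn)ˣ` and the fibre differences of a piece

Part 1 of 9 (Sketch Part 1 §Split + Part A, ll. 42–240). Target of the chain: lead c4's `CoprimeSix.hodgeConjectureFor_general` WITHOUT `htwin : ¬ p₁ (p₁+2) ∣ m`.
Both bad-prime branches of c4's `fibre_of_top_level_general` end in the configuration `M = p₁ · p₀ · n''` (`p₀ = p₁ + 2` prime), `T = 𝟙_S`, `#S = p₁ + 1 = p₀ - 1`,
`T ⊥` odd primitive characters, room at the primes of `n''`; the chain proves the two-prime LOCAL LEMMA replacing c2/c4's one-prime `even_or_fibre_of_boundary_(pow_)nat`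
there and re-runs c4's level analysis and pay-off. Here: `sum_defect_mul_char_eq_zero_all`, `apply_eq_split_all`, **`split_of_orthogonal_all`** — PARITY-FREE Fourier
split: `E ⊥ χ₁ ⊠ χ₂` for all `χ₁ ≠ 1 ≠ χ₂` ⟹ `E(x) = G(x mod n) + H(x mod q)` on units — and **`piece_fibreDiff_orthogonal`** (c4's `hclaim` with the first
factor `q₀` arbitrary: the fibre differences `D_b(a) = Tp(crt⁻¹(a,b)) - Tp(-crt⁻¹(a,b))` of a piece are killed by EVERY primitive `χ₁ mod q₀`).

PROVENANCE. Cell hodge-nonav (HUMAN RULING D-0038), planner seat p1 g33: chapter ROUTE-P1AF addenda ADD4 ∕ ADD5 (memos `HOME/memos/ROUTE-P1AF-ADD4.md`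
b7ad80a65555c84d, `…-ADD5.md` ffaf9911041dfeba; referee PASS 0∕0: ref g52 REF-P1AF-ADD4.md 83f6fe06da4ed38e, ref g53 REF-P1AF-ADD5.md bcccb0bceb665800),
frozen Sketch `HOME/p1/route/Sketch_P1AF_RGENTWIN_g33.lean` (sha16 596f05bb769cab0c, 1805 lines, namespaces `HodgeNonAV.P1AF.GenTwin` + the line's
`…CancelByAnyClaimLattice.PairedNull ∕ .CoprimeSix`, farm rc 0 / 0 sorries / axioms {propext, Classical.choice, Quot.sound}; re-elaborated 2026-08-28), split into
nine tree modules `…GeneralTwinSplit` → `…GeneralTwinLocal` → `…GeneralTwinLevel` → `…GeneralTwinLevelOne` → `…GeneralTwinGlue` → `…FibreOfTopLevelGeneralTwinKey` → `…FibreOfTopLevelGeneralTwin` →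
`…FibreOfProgressionGeneralTwin` → `…GeneralTwinPayoff` by planner p1 g34 (landing kit HOME/p1/landing/); proof bodies verbatim (cell namespace renamed
`…Theorems.CancelByAnyClaimLattice.GenTwin`); docstrings reworded per referee rider N-ADD4-1 (Aoki 1983 cites are METHOD attributions; the statements without
the twin exclusion are not in print). Target: lead c4's `CoprimeSix.hodgeConjectureFor_general` (`Theorems/…GeneralPayoff`) WITHOUT the hypothesis
`htwin : ¬ p₁ (p₁+2) ∣ m` — replaced by `(p₁+2)² ∤ m`. Land with `--supports stmt-HodgeConjecture-1334` (line `cancel-by-any-claim-lattice` of crux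
`HodgeFermatVarieties`, route `PadicSemiregularLift`). No instance, no new notation (the `local notation3` of Parts 2, 3 and 9 are the line's, verbatim from
`Theorems/PadicSemiregularLiftHodgeFermatVarietiesFibreOfBoundaryPow` ∕ `…GeneralPayoff`), no sorry, no new axiom.
HONEST SCOPE: the HC pay-off `hodgeConjectureFor_general₂` is MODULO the line's named facts (S0) and stub statements (S2↑, S2↓, S3a, S5), exactly as c4's
`hodgeConjectureFor_general`; Fermat varieties are dominated by abelian motives (inside the known AV region); NOTHING here proves the Hodge conjecture.
References (method): N. Aoki, Math. Ann. 266 (1983) Thm A′ (§7), Prop. 2.2, Prop. 6.4, §9 [cite: Aoki1983, Thm. A]; N. Aoki, J. Math. Soc. Japan 39 (1987)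
Thm 1-1, Thm 2-1 [cite: Aoki1987, Thm. 2-1]; T. Shioda, Proc. Japan Acad. 55 (1979) §2 Thm 1 [cite: Shioda1979PJA, Thm. 1].
-/

set_option linter.dupNamespace false

noncomputable section

namespace Summit.HodgeConjecture.HodgeConjecture.Theorems.CancelByAnyClaimLattice.GenTwin

open Finset
open Literature.AlgebraicGeometry.HodgeTheory Literature.AlgebraicGeometry.HodgeTheory.FermatCharacter
open Summit.HodgeConjecture.HodgeConjecture.Theorems.CancelByAnyClaimLattice
open Summit.HodgeConjecture.HodgeConjecture.Theorems.CancelByAnyClaimLattice.PairedNull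
open Summit.HodgeConjecture.HodgeConjecture.Theorems.CancelByAnyClaimLattice.FiveQ.FourierSplit

section Split

variable {q n : ℕ} [NeZero q] [NeZero n] (h : q.Coprime n)
  (ℓ : (ZMod q)ˣ → (ZMod n)ˣ → (ZMod (q * n))ˣ)
  (hℓ₁ : ∀ a b, ZMod.unitsMap (dvd_mul_right q n) (ℓ a b) = a)
  (hℓ₂ : ∀ a b, ZMod.unitsMap (dvd_mul_left n q) (ℓ a b) = b)
include h hℓ₁ hℓ₂

/-- **The parity-free defect is orthogonal to every character.** With `S(x) = ∑_a E(ℓ(a,1)x)`,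
`T(x) = ∑_b E(ℓ(1,b)x)`, `K(x) = ∑_a ∑_b E(ℓ(a,1)(ℓ(1,b)x))`:
`⟨E - S/φ(q) - T/φ(n) + K/(φ(q)φ(n)), χ⟩ = ⟨E,χ⟩(1-[χ₁=1])(1-[χ₂=1]) = 0`. -/
theorem sum_defect_mul_char_eq_zero_all (E : ZMod (q * n) → ℂ)
    (horth : ∀ (χ₁ : DirichletCharacter ℂ q) (χ₂ : DirichletCharacter ℂ n), χ₁ ≠ 1 → χ₂ ≠ 1 →
      ∑ x : ZMod (q * n), E x * (DirichletCharacter.changeLevel (dvd_mul_right q n) χ₁ *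
        DirichletCharacter.changeLevel (dvd_mul_left n q) χ₂) x = 0)
    (χ : DirichletCharacter ℂ (q * n)) :
    ∑ x : ZMod (q * n), (E x -
        ((q.totient : ℂ))⁻¹ * ∑ a : (ZMod q)ˣ, E (((ℓ a 1 : (ZMod (q * n))ˣ) : ZMod (q * n)) * x) -
        ((n.totient : ℂ))⁻¹ * ∑ b : (ZMod n)ˣ, E (((ℓ 1 b : (ZMod (q * n))ˣ) : ZMod (q * n)) * x) +
        ((q.totient : ℂ))⁻¹ * ((n.totient : ℂ))⁻¹ *
          ∑ a : (ZMod q)ˣ, ∑ b : (ZMod n)ˣ,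
            E (((ℓ 1 b : (ZMod (q * n))ˣ) : ZMod (q * n)) * ((((ℓ a 1 : (ZMod (q * n))ˣ) : ZMod (q * n)) * x)))) *
      χ x = 0 := by
  obtain ⟨χ₁, χ₂, rfl, -⟩ := exists_eq_prodChar h χ
  have hq : (q.totient : ℂ) ≠ 0 := by exact_mod_cast (Nat.totient_pos.mpr (NeZero.pos q)).ne'
  have hn : (n.totient : ℂ) ≠ 0 := by exact_mod_cast (Nat.totient_pos.mpr (NeZero.pos n)).ne'
  have hsplit : ∀ (c A B C D : ℂ),
      (A - ((q.totient : ℂ))⁻¹ * B - ((n.totient : ℂ))⁻¹ * C +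
          ((q.totient : ℂ))⁻¹ * ((n.totient : ℂ))⁻¹ * D) * c =
        A * c - ((q.totient : ℂ))⁻¹ * (B * c) - ((n.totient : ℂ))⁻¹ * (C * c) +
          ((q.totient : ℂ))⁻¹ * ((n.totient : ℂ))⁻¹ * (D * c) := by
    intros; ring
  simp_rw [hsplit]
  rw [Finset.sum_add_distrib, Finset.sum_sub_distrib, Finset.sum_sub_distrib, ← Finset.mul_sum,
    ← Finset.mul_sum, ← Finset.mul_sum,
    sum_fibreLeft_mul_prodChar ℓ hℓ₁ hℓ₂, sum_fibreRight_mul_prodChar ℓ hℓ₁ hℓ₂]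
  -- the double fibre sum: left fibre sum of the right fibre sum
  rw [sum_fibreLeft_mul_prodChar ℓ hℓ₁ hℓ₂ (fun y ↦ ∑ b : (ZMod n)ˣ, E (((ℓ 1 b : (ZMod (q * n))ˣ) : ZMod (q * n)) * y)),
    sum_fibreRight_mul_prodChar ℓ hℓ₁ hℓ₂]
  set Ω := ∑ x : ZMod (q * n), E x * (DirichletCharacter.changeLevel (dvd_mul_right q n) χ₁ *
    DirichletCharacter.changeLevel (dvd_mul_left n q) χ₂) x with hΩ
  rcases eq_or_ne χ₁ 1 with rfl | h1 <;> rcases eq_or_ne χ₂ 1 with rfl | h2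
  · rw [sum_units_one_inv, sum_units_one_inv]
    field_simp
    ring
  · rw [sum_units_one_inv, sum_units_char_inv_eq_zero h2]
    field_simp
    ring
  · rw [sum_units_one_inv, sum_units_char_inv_eq_zero h1]
    field_simp
    ring
  · rw [sum_units_char_inv_eq_zero h1, sum_units_char_inv_eq_zero h2, hΩ, horth χ₁ χ₂ h1 h2]
    ring

/-- **Parity-free Fourier split.** If `E : ℤ/(qn) → ℂ` is orthogonal to every `χ₁ ⊠ χ₂` with
`χ₁ ≠ 1 ≠ χ₂`, then with `G(b) = φ(q)⁻¹ ∑_a E(ℓ(a,b))`, `c₀ = φ(q)⁻¹ φ(n)⁻¹ ∑_a ∑_b E(ℓ(a,b))` and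
`H(a) = φ(n)⁻¹ ∑_b E(ℓ(a,b)) - c₀`: `E(w) = G(w mod n) + H(w mod q)` for every unit `w`. -/
theorem apply_eq_split_all (E : ZMod (q * n) → ℂ)
    (horth : ∀ (χ₁ : DirichletCharacter ℂ q) (χ₂ : DirichletCharacter ℂ n), χ₁ ≠ 1 → χ₂ ≠ 1 →
      ∑ x : ZMod (q * n), E x * (DirichletCharacter.changeLevel (dvd_mul_right q n) χ₁ *
        DirichletCharacter.changeLevel (dvd_mul_left n q) χ₂) x = 0)
    (w : (ZMod (q * n))ˣ) :
    E w = ((q.totient : ℂ))⁻¹ * ∑ a : (ZMod q)ˣ, E ((ℓ a (ZMod.unitsMap (dvd_mul_left n q) w) : (ZMod (q * n))ˣ) : ZMod (q * n)) +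
      (((n.totient : ℂ))⁻¹ * ∑ b : (ZMod n)ˣ, E ((ℓ (ZMod.unitsMap (dvd_mul_right q n) w) b : (ZMod (q * n))ˣ) : ZMod (q * n)) -
        ((q.totient : ℂ))⁻¹ * ((n.totient : ℂ))⁻¹ *
          ∑ a : (ZMod q)ˣ, ∑ b : (ZMod n)ˣ, E ((ℓ a b : (ZMod (q * n))ˣ) : ZMod (q * n))) := by
  classical
  have key := totient_mul_apply_eq_sum_char (fun x ↦ E x -
    ((q.totient : ℂ))⁻¹ * ∑ a : (ZMod q)ˣ, E (((ℓ a 1 : (ZMod (q * n))ˣ) : ZMod (q * n)) * x) -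
    ((n.totient : ℂ))⁻¹ * ∑ b : (ZMod n)ˣ, E (((ℓ 1 b : (ZMod (q * n))ˣ) : ZMod (q * n)) * x) +
    ((q.totient : ℂ))⁻¹ * ((n.totient : ℂ))⁻¹ *
      ∑ a : (ZMod q)ˣ, ∑ b : (ZMod n)ˣ,
        E (((ℓ 1 b : (ZMod (q * n))ˣ) : ZMod (q * n)) * ((((ℓ a 1 : (ZMod (q * n))ˣ) : ZMod (q * n)) * x)))) w
  simp only [sum_defect_mul_char_eq_zero_all h ℓ hℓ₁ hℓ₂ E horth, mul_zero,
    Finset.sum_const_zero] at key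
  have hN : ((q * n).totient : ℂ) ≠ 0 := by
    exact_mod_cast (Nat.totient_pos.mpr (NeZero.pos (q * n))).ne'
  have h0 := (mul_eq_zero.mp key).resolve_left hN
  -- identify the three fibre sums at the unit `w`
  have hS := fibreLeft_coe h ℓ hℓ₁ hℓ₂ E w
  have hT := fibreRight_coe h ℓ hℓ₁ hℓ₂ E w
  have hK : ∑ a : (ZMod q)ˣ, ∑ b : (ZMod n)ˣ,
      E (((ℓ 1 b : (ZMod (q * n))ˣ) : ZMod (q * n)) * ((((ℓ a 1 : (ZMod (q * n))ˣ) : ZMod (q * n)) * (w : ZMod (q * n))))) =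
      ∑ a : (ZMod q)ˣ, ∑ b : (ZMod n)ˣ, E ((ℓ a b : (ZMod (q * n))ˣ) : ZMod (q * n)) := by
    have step : ∀ a : (ZMod q)ˣ, ∑ b : (ZMod n)ˣ,
        E (((ℓ 1 b : (ZMod (q * n))ˣ) : ZMod (q * n)) * ((((ℓ a 1 : (ZMod (q * n))ˣ) : ZMod (q * n)) * (w : ZMod (q * n))))) =
        ∑ b : (ZMod n)ˣ, E ((ℓ (a * ZMod.unitsMap (dvd_mul_right q n) w) b : (ZMod (q * n))ˣ) : ZMod (q * n)) := by
      intro a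
      have := fibreRight_coe h ℓ hℓ₁ hℓ₂ E (ℓ a 1 * w)
      rw [Units.val_mul] at this
      rw [this, map_mul, hℓ₁]
    simp_rw [step]
    exact Fintype.sum_bijective (fun a ↦ a * ZMod.unitsMap (dvd_mul_right q n) w)
      (Group.mulRight_bijective _) _ _ (fun a ↦ rfl)
  rw [hS, hT, hK] at h0
  linear_combination h0

end Split

/-- **Parity-free Fourier split, packaged.** For coprime `q, n` and `E : ℤ/(qn) → ℂ` orthogonal to every
`χ₁ ⊠ χ₂` with both components non-trivial, there are `G : (ℤ/n)ˣ → ℂ`, `H : (ℤ/q)ˣ → ℂ` with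
`E(x) = G(x mod n) + H(x mod q)` for every unit `x`. [folklore] -/
theorem split_of_orthogonal_all (q n : ℕ) [NeZero q] [NeZero n] (h : q.Coprime n) (E : ZMod (q * n) → ℂ)
    (horth : ∀ (χ₁ : DirichletCharacter ℂ q) (χ₂ : DirichletCharacter ℂ n), χ₁ ≠ 1 → χ₂ ≠ 1 →
      ∑ x : ZMod (q * n), E x * (DirichletCharacter.changeLevel (dvd_mul_right q n) χ₁ *
        DirichletCharacter.changeLevel (dvd_mul_left n q) χ₂) x = 0) :
    ∃ (G : (ZMod n)ˣ → ℂ) (H : (ZMod q)ˣ → ℂ),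
      ∀ x : (ZMod (q * n))ˣ, E (x : ZMod (q * n)) =
        G (ZMod.unitsMap (dvd_mul_left n q) x) + H (ZMod.unitsMap (dvd_mul_right q n) x) := by
  choose ℓ hℓ₁ hℓ₂ using fun (a : (ZMod q)ˣ) (b : (ZMod n)ˣ) ↦ exists_unit_crt h a b
  refine ⟨fun b ↦ ((q.totient : ℂ))⁻¹ * ∑ a : (ZMod q)ˣ, E ((ℓ a b : (ZMod (q * n))ˣ) : ZMod (q * n)),
    fun a ↦ ((n.totient : ℂ))⁻¹ * ∑ b : (ZMod n)ˣ, E ((ℓ a b : (ZMod (q * n))ˣ) : ZMod (q * n)) -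
      ((q.totient : ℂ))⁻¹ * ((n.totient : ℂ))⁻¹ *
        ∑ a : (ZMod q)ˣ, ∑ b : (ZMod n)ˣ, E ((ℓ a b : (ZMod (q * n))ˣ) : ZMod (q * n)), fun x ↦ ?_⟩
  exact apply_eq_split_all h ℓ hℓ₁ hℓ₂ E horth x


/-! ## Part A — fibre differences of a piece -/


section PieceA

variable {q₀ n : ℕ} [NeZero q₀] [NeZero n]

/-- `πq[p']` — reduction from level `q₀ · n` to the prime power `p' ^ v_{p'}(n)` of `n`. Local notation (c2/c4). -/
local notation3 (prettyPrint := false) "πq[" p' "]" =>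
  ZMod.castHom ((Nat.ordProj_dvd n p').trans (dvd_mul_left n q₀)) (ZMod (p' ^ n.factorization p'))

/-- `Reg[P, x, z]` — `z ≡ ±x` modulo `p' ^ v_{p'}(n)` for every `p' ∈ P`. Local notation (c2/c4). -/
local notation3 (prettyPrint := false) "Reg[" P ", " x ", " z "]" =>
  ∀ p' ∈ (P : Finset ℕ), πq[p'] z = πq[p'] x ∨ πq[p'] z = -(πq[p'] x)

/-- **Fibre differences of a piece are killed by every primitive character mod `q₀`.** Let `Tp : ℤ/(q₀ n) → ℂ`
(`q₀` coprime to `n`, all primes of `n` `≥ 5`) be annihilated by every odd primitive character mod `q₀ n` and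
supported on units lying in the region of a unit `x` at all primes of `n`. Then for every `b : ℤ/n` the
function `D_b(a) = Tp(crt⁻¹(a,b)) - Tp(-crt⁻¹(a,b))` on `ℤ/q₀` satisfies `∑_a D_b(a) χ₁(a) = 0` for every
PRIMITIVE character `χ₁` mod `q₀` (of either parity). [cite: Aoki1983, §9; c2 `fibre_const_of_piece`,
c4 `fibre_const_of_piece_pow`] -/
theorem piece_fibreDiff_orthogonal (hc : q₀.Coprime n) (hn5 : ∀ p' ∈ n.primeFactors, 5 ≤ p')
    (Tp : ZMod (q₀ * n) → ℂ)
    (hTp : ∀ χ : DirichletCharacter ℂ (q₀ * n), χ.Odd → χ.IsPrimitive → ∑ z : ZMod (q₀ * n), Tp z * χ z = 0)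
    {x : ZMod (q₀ * n)} (hx : IsUnit x)
    (hsupp : ∀ z, Tp z ≠ 0 → IsUnit z ∧ Reg[n.primeFactors, x, z])
    (b : ZMod n) (χ₁ : DirichletCharacter ℂ q₀) (hχ₁p : χ₁.IsPrimitive) :
    ∑ a : ZMod q₀, (Tp ((ZMod.chineseRemainder hc).symm (a, b)) -
      Tp (-(ZMod.chineseRemainder hc).symm (a, b))) * χ₁ a = 0 := by
  classical
  set D : ZMod q₀ → ℂ := fun a ↦ Tp ((ZMod.chineseRemainder hc).symm (a, b)) -
    Tp (-(ZMod.chineseRemainder hc).symm (a, b)) with hD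
  set A : (ZMod n)ˣ := (hx.map (ZMod.castHom (dvd_mul_left n q₀) (ZMod n))).unit with hA
  set σ : ℂ := χ₁ (-1) with hσ
  have hσsq : σ * σ = 1 := by rw [hσ, ← map_mul, neg_one_mul, neg_neg, map_one]
  have hσpm : σ = 1 ∨ σ = -1 := char_neg_one_eq_or χ₁
  set H : ZMod n → ℂ := fun b' ↦ ∑ a : ZMod q₀, Tp ((ZMod.chineseRemainder hc).symm (a, b')) * χ₁ a with hH
  -- (i) support of `H` on the sign orbit of `A`
  have hHsupp : ∀ b', H b' ≠ 0 → ∃ u : (ZMod n)ˣ, u * u = 1 ∧ b' = (u : ZMod n) * A := by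
    intro b' hb'
    obtain ⟨a, -, ha⟩ := Finset.exists_ne_zero_of_sum_ne_zero hb'
    have hz : Tp ((ZMod.chineseRemainder hc).symm (a, b')) ≠ 0 := fun h0 ↦ ha (by rw [h0, zero_mul])
    obtain ⟨hzu, hreg⟩ := hsupp _ hz
    obtain ⟨u, hu, hub⟩ := exists_sq_eq_one_of_region (dvd_mul_left n q₀) hx hzu hreg
    refine ⟨u, hu, ?_⟩
    rw [(castHom_crt_symm hc a b').2] at hub
    exact hub
  -- (ii) `H` is orthogonal to the primitive characters of parity `-σ`
  have hHnull : ∀ χ₂ : DirichletCharacter ℂ n, χ₂.IsPrimitive → χ₂ (-1) = -σ →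
      ∑ b' : ZMod n, H b' * χ₂ b' = 0 := by
    intro χ₂ hχ₂ hpar
    have hprim := prodChar_isPrimitive hc hχ₁p hχ₂
    have hodd : (DirichletCharacter.changeLevel (dvd_mul_right q₀ n) χ₁ *
        DirichletCharacter.changeLevel (dvd_mul_left n q₀) χ₂).Odd := by
      rw [DirichletCharacter.Odd, prodChar_neg_one, hpar, ← hσ]
      linear_combination (-1 : ℂ) * hσsq
    have key := hTp _ hodd hprim
    rw [sum_mul_prodChar_eq hc] at key
    simp_rw [Finset.mul_sum] at key
    rw [Finset.sum_comm] at key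
    rw [← key]
    refine Finset.sum_congr rfl fun b' _ ↦ ?_
    rw [hH, Finset.sum_mul]
    exact Finset.sum_congr rfl fun a _ ↦ by ring
  -- (iii) the sign-orbit lemma
  have hτ : (-σ = 1 ∨ -σ = -1) := by rcases hσpm with h | h <;> rw [h] <;> norm_num
  have horbit := orbit_sign n hn5 (-σ) hτ H A hHsupp hHnull
  -- (iv) `∑ D χ₁ = H b - σ H(-b) = 0`
  have hneg : ∑ a : ZMod q₀, Tp (-(ZMod.chineseRemainder hc).symm (a, b)) * χ₁ a = σ * H (-b) := by
    rw [hH, Finset.mul_sum, ← Equiv.sum_comp (Equiv.neg (ZMod q₀))]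
    refine Finset.sum_congr rfl fun a _ ↦ ?_
    rw [Equiv.neg_apply, ← crt_symm_neg, neg_neg,
      show χ₁ (-a) = χ₁ (-1) * χ₁ a by rw [← map_mul, neg_one_mul], ← hσ]
    ring
  have hsplit : ∑ a : ZMod q₀, D a * χ₁ a = H b - ∑ a : ZMod q₀, Tp (-(ZMod.chineseRemainder hc).symm (a, b)) * χ₁ a := by
    rw [hH, ← Finset.sum_sub_distrib]
    exact Finset.sum_congr rfl fun a _ ↦ by rw [hD]; ring
  change ∑ a : ZMod q₀, D a * χ₁ a = 0
  rw [hsplit, hneg, horbit b]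
  linear_combination (-(H b)) * hσsq

end PieceA

end Summit.HodgeConjecture.HodgeConjecture.Theorems.CancelByAnyClaimLattice.GenTwin

end
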